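import Summits.QuantumFields.BalabanUV.T4Continuum.Support.NE7StraightSliceB5Transfer
import Summits.QuantumFields.BalabanUV.Beta.GAN24.Entry115SupCubic
import Summits.QuantumFields.BalabanUV.Beta.GAN24.AveragedPropagatorInverseUniform
import Literature.MathematicalPhysics.QuantumFieldTheory.Balaban1983to89.B5G115SupBound
import HarnessLib

/-!
# NE7StraightSliceB5Letter — row NE7 (node U5), the (A)-bill's XL(c): (142)'s RANK-ONE STRAIGHT SOURCE LETTER `h1src` **PROVED** ON EVERY CUBIC TORUS, at `a = 1`,
# from the tree's kernel theorems for Bałaban's `G = Δ_1⁻¹` and `(QGQ*)⁻¹` — lit-balaban's `B5G115SupBound` ((1.115) entry `|GJ|`), the G-an2-4 team's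
# `Beta/GAN24/Entry115SupCubic` ((1.115) entry `|∇GJ|`, cubic tori) and `Beta/GAN24/AveragedPropagatorInverseUniform` (the sup bound of `(QGQ*)⁻¹`), through (147) §7

Lineage `b2b-balaban-t4-ne7-p2` (CRUX PROVER NE7 #2, co-owner of row NE7), generation 84 (staged behind (145) ∕ (150) ∕ (147)).  Over (147) `NE7StraightSliceB5Transfer`
(`rankOneSourceSolver_of_G115_QGQinv`: `h1src` ⟸ `hG1 ∧ hG0 ∧ hE`) and THREE KERNEL THEOREMS OF THE TREE (none of them a hypothesis, none of them ours):
`B5G115SupBound.norm_DeltaA_one_inv_mulVec_le_global` («|GJ| ≤ O(1)|J|», every torus, `a = 1`), `GAN24.Entry115SupCubic.norm_fdiff_inv_mulVec_le_cubic` («|∇GJ| ≤ O(1)|J|»,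
cubic tori, uniformly in the spacing `n` and the volume), `GAN24.AveragedPropagatorInverseUniform.exists_QGQ_inv_sup` (`|(QGQ*)⁻¹v| ≤ O(1)|v|`, every torus, every `a > 0`, uniformly).
WHAT.  §1 `CurlOp_mulVec_apply_eq_fdiff` (`(∂_cA)(x, μ, ν) = (∇_μA)_ν(x) − (∇_νA)_μ(x)`); §2 `curl_inv_one_sup_cubic` (hG1 at `a = 1`: `|∂_n(Δ_1⁻¹J)| ≤ 2C·|J|_∞` on cubic tori),
`inv_one_sup_exists` (hG0 at `a = 1`, every torus); §3 **`rankOneSourceSolver_holds`**: `∃ K = K(d) ≥ 0` such that for EVERY `L ≥ 1`, `j`, `N ≥ 1` with `L^j·N ≥ 2`, (142)'s letter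
`h1src` holds in dimension `d + 1` on the period `L^j·N` with `K₁ = L^j·K` — i.e. **THE (A)-BILL's XL(c) INPUT IS DISCHARGED on cubic tori**: with (142)
`sliceSolver_end_of_rankOneSourceSolver` (queued p381062) F54 v3's slice-solver letter `hG` follows with `K_G = (1 + 2(d+1)·C_fr(d+1,L))·(2n³·L^(k+1)·K(d))`.
HONEST FRAMING (page 1): composition BY NAME of kernel theorems of the tree (lit-balaban pass pv15's `B5G115SupBound`, the G-an2-4 formalisation swarm's `Entry115SupCubic` ∕
`AveragedPropagatorInverseUniform`, the β sub-cell's `Beta.FluctuationProjection`) with this lineage's (137)–(150); the analysis is THEIRS (Combes–Thomas ∕ (1.66) strip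
analyticity ∕ (1.83) kernels), the docking is ours; `a = 1`, `U = 1`, CUBIC tori `(N,…,N)`, dimension `d + 1`; the constant `K(d)` is existential in size (d-only); `K₁ = L^j·K`
grows with the block scale `L^j = L^(k+1)` exactly as memo §7 (vii) announced — whether the (A)-bill tolerates that growth is the OWNER's ∕ the desk's arithmetic, NOT claimed here.
NOT (APE), NOT ONE-STEP, NOT NE7; spine 0∕9; finite T⁴ rung (B)+1 — NOT infinite volume, NOT mass gap, NOT Clay.  Continuum YM on T⁴ ⇐ BetaPertH ∧ nine spine estimates
(0/9 proved); BetaPertH ⇐ (D1) ∧ (D4) ∧ CAP+tail; G-an2-4 gates asym, D1 and NE2/3/4.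
-/

set_option autoImplicit false

open scoped BigOperators Matrix Matrix.Norms.L2Operator ComplexConjugate
open Finset

namespace Summit.QuantumFields.BalabanUV.T4Continuum.NE7StraightSliceB5Letter

open Literature.MathematicalPhysics.QuantumFieldTheory.Balaban1983to89
open B7Prop1Explicit
open B5Prop11Plancherel (Tor fine fdiff calG)
open B5Action121 (CurlOp CurlOp_mulVec Fs_apply fdiff_mulVec_apply sdiff_mulVec comp)
open B5DeltaA169 (DeltaA calG_eq_DeltaA_inv)
open T4AveragingDeficitWall (curlAt IsSkewDir)
open T4AveragingDeficitWallBoundary (periodBox)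
open AveragingDeficitPeriodicCounting (IsPeriodicDir)
open MinimalActionLevels (perWin)
open BlockAveragePushDirSplit (flat)
open NE3HessForm (hess)
open NE3TangentFlatStructure (Qcoarse)
open NE7FlatSliceSourceDuality (srcPair)
open NE7StraightSliceB5Transfer (rankOneSourceSolver_of_G115_QGQinv)
open Summit.QuantumFields.BalabanUV.Beta.GAN24.Entry115SupCubic (norm_fdiff_inv_mulVec_le_cubic)
open Summit.QuantumFields.BalabanUV.Beta.GAN24.AveragedPropagatorInverseUniform (exists_QGQ_inv_sup)
open B5G115SupBound (norm_DeltaA_one_inv_mulVec_le_global)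

noncomputable section

variable {d : ℕ}

local notation "𝕄₁" => Matrix (Fin 1) (Fin 1) ℂ

/-! ## §1 The curl is a difference of two gradients -/

/-- `(∂_cA)(x, μ, ν) = (∇_μA)_ν(x) − (∇_νA)_μ(x)` for lit-balaban's `CurlOp` and `fdiff`. [cite: Balaban1984PropagatorsI, (1.2) p.18, (1.31) p.23] -/
theorem CurlOp_mulVec_apply_eq_fdiff (N : Fin d → ℕ) [∀ μ, NeZero (N μ)] (c : ℂ) (A : Tor N × Fin d → ℂ) (x : Tor N) (μ ν : Fin d) :
    (CurlOp N c *ᵥ A) (x, (μ, ν)) = (fdiff N c μ *ᵥ A) (x, ν) - (fdiff N c ν *ᵥ A) (x, μ) := by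
  rw [CurlOp_mulVec, Fs_apply, fdiff_mulVec_apply, fdiff_mulVec_apply, sdiff_mulVec, sdiff_mulVec]
  simp only [comp]
  ring

/-! ## §2 The two (1.115) entries at `a = 1`, in the shape (147) §7 consumes -/

/-- **hG1 at `a = 1` on cubic tori**: `∃ C₁ > 0` (d-only) with `|∂_n(Δ_1⁻¹J)| ≤ C₁·|J|_∞` for every spacing `n ≥ 1` and every cubic unit torus — twice the G-an2-4 team's
(1.115) gradient entry `Entry115SupCubic.norm_fdiff_inv_mulVec_le_cubic`. [cite: Balaban1984PropagatorsI, (1.115) p.36] -/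
theorem curl_inv_one_sup_cubic :
    ∃ C₁ : ℝ, 0 < C₁ ∧ ∀ (n N₀ : ℕ) [NeZero n] [NeZero N₀] (J : Tor (fine n (fun _ : Fin (d + 1) => N₀)) × Fin (d + 1) → ℂ) (g : ℝ),
      (∀ p, ‖J p‖ ≤ g) → ∀ q : Tor (fine n (fun _ : Fin (d + 1) => N₀)) × (Fin (d + 1) × Fin (d + 1)),
        ‖(CurlOp (fine n (fun _ : Fin (d + 1) => N₀)) (n : ℂ) *ᵥ ((DeltaA n (fun _ : Fin (d + 1) => N₀) 1)⁻¹ *ᵥ J)) q‖ ≤ C₁ * g := by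
  obtain ⟨C, hC, h⟩ := norm_fdiff_inv_mulVec_le_cubic (d := d)
  refine ⟨2 * C, by positivity, fun n N₀ _ _ J g hJ q => ?_⟩
  obtain ⟨x, μ, ν⟩ := q
  rw [CurlOp_mulVec_apply_eq_fdiff]
  calc _ ≤ ‖(fdiff (fine n (fun _ : Fin (d + 1) => N₀)) (n : ℂ) μ *ᵥ ((DeltaA n (fun _ : Fin (d + 1) => N₀) 1)⁻¹ *ᵥ J)) (x, ν)‖
          + ‖(fdiff (fine n (fun _ : Fin (d + 1) => N₀)) (n : ℂ) ν *ᵥ ((DeltaA n (fun _ : Fin (d + 1) => N₀) 1)⁻¹ *ᵥ J)) (x, μ)‖ := norm_sub_le _ _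
    _ ≤ C * g + C * g := add_le_add (h n N₀ μ J g hJ (x, ν)) (h n N₀ ν J g hJ (x, μ))
    _ = 2 * C * g := by ring

/-- **hG0 at `a = 1` on every torus**: `∃ C₀` (d-only) with `|Δ_1⁻¹J| ≤ C₀·|J|_∞` — lit-balaban's (1.115) first entry `B5G115SupBound.norm_DeltaA_one_inv_mulVec_le_global`
(at its parameter `N := d`). [cite: Balaban1984PropagatorsI, (1.115) p.36] -/
theorem inv_one_sup_exists :
    ∃ C₀ : ℝ, ∀ (n : ℕ) [NeZero n] (_hn : 1 ≤ n) (M : Fin (d + 1) → ℕ) [∀ μ, NeZero (M μ)] (J : Tor (fine n M) × Fin (d + 1) → ℂ) (g : ℝ),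
      (∀ p, ‖J p‖ ≤ g) → ∀ p : Tor (fine n M) × Fin (d + 1), ‖((DeltaA n M 1)⁻¹ *ᵥ J) p‖ ≤ g * C₀ :=
  ⟨_, fun n _ hn M _ J _g hJ p => norm_DeltaA_one_inv_mulVec_le_global n hn M (Nn := d) le_rfl J hJ p⟩

/-! ## §3 The letter, proved -/

/-- **(142)'s RANK-ONE STRAIGHT SOURCE LETTER HOLDS ON EVERY CUBIC TORUS** (dimension `d + 1`, `a = 1`): there is `K = K(d)` such that for every `L ≥ 1`, `j`, `N ≥ 1` with
`L^j·N ≥ 2`: every skew `L^j·N`-periodic rank-one `ξ` with `(Qcoarse L)^[j] ξ = 0` that solves `hess 1 ξ ζ (perWin (d+1) (L^j·N)) = srcPair h ζ (periodBox (L^j·N))` against all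
skew periodic straight `ζ`, for a skew periodic source `h` with `|h| ≤ g`, has `‖curlAt 1 ξ z μ ν‖ ≤ (L^j·K)·g` everywhere.  PROOF = (147) §7 at `a = 1` fed with the tree's
`B5G115SupBound` (|GJ|), `GAN24.Entry115SupCubic` (|∇GJ|) and `GAN24.AveragedPropagatorInverseUniform` (|(QGQ*)⁻¹v|). [cite: Balaban1984PropagatorsI, (1.103) p.34, (1.115) p.36] -/
theorem rankOneSourceSolver_holds (d : ℕ) :
    ∃ K : ℝ, 0 ≤ K ∧ ∀ (L : ℕ) [NeZero L] (_hL : 1 ≤ L) (j Mc : ℕ) [NeZero Mc] (_hP : 2 ≤ L ^ j * Mc),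
      ∀ ξ : Site (d + 1) → Fin (d + 1) → 𝕄₁, IsSkewDir ξ → IsPeriodicDir ξ ((L ^ j * Mc : ℕ) : ℤ) → (Qcoarse L)^[j] ξ = 0 →
      ∀ h : Site (d + 1) → Fin (d + 1) → 𝕄₁, IsSkewDir h → IsPeriodicDir h ((L ^ j * Mc : ℕ) : ℤ) → ∀ g : ℝ, 0 ≤ g →
      (∀ (x : Site (d + 1)) (κ : Fin (d + 1)), ‖h x κ‖ ≤ g) →
      (∀ ζ : Site (d + 1) → Fin (d + 1) → 𝕄₁, IsSkewDir ζ → IsPeriodicDir ζ ((L ^ j * Mc : ℕ) : ℤ) → (Qcoarse L)^[j] ζ = 0 →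
        hess (flat (d := d + 1) (n := Fin 1)) ξ ζ (perWin (d + 1) (L ^ j * Mc)) = srcPair h ζ (periodBox (d := d + 1) (L ^ j * Mc))) →
      ∀ (z : Site (d + 1)) (μ ν : Fin (d + 1)), μ ≠ ν → ‖curlAt (flat (d := d + 1) (n := Fin 1)) ξ z μ ν‖ ≤ (((L ^ j : ℕ) : ℝ) * K) * g := by
  obtain ⟨C₁, hC₁, hG1⟩ := curl_inv_one_sup_cubic (d := d)
  obtain ⟨C₀, hG0⟩ := inv_one_sup_exists (d := d)
  obtain ⟨c₀, δ₀, hc₀, hδ₀, hE⟩ := exists_QGQ_inv_sup (d := d)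
  -- signs: `C₀ ≥ 0` from the bound at `J = 0`; the lattice constant is nonnegative
  have hC₀ : 0 ≤ C₀ := by
    have h := hG0 1 le_rfl (fun _ : Fin (d + 1) => 1) 0 1 (fun p => by rw [Pi.zero_apply, norm_zero]; exact zero_le_one) (0, 0)
    rw [Matrix.mulVec_zero, Pi.zero_apply, norm_zero, one_mul] at h
    exact h
  have hCE : 0 ≤ ((d : ℝ) + 1) * (1 + c₀) * B4Sect5Proof.latticeConst (d + 1) δ₀ := by
    have hK := B4Sect5Proof.latticeConst_nonneg (d + 1) hδ₀.le
    positivity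
  refine ⟨C₁ + C₁ * (((d : ℝ) + 1) * (1 + c₀) * B4Sect5Proof.latticeConst (d + 1) δ₀) * C₀, by positivity, fun L _ hL j Mc _ hP => ?_⟩
  exact rankOneSourceSolver_of_G115_QGQinv (C₁ := C₁) (C₀ := C₀) (CE := ((d : ℝ) + 1) * (1 + c₀) * B4Sect5Proof.latticeConst (d + 1) δ₀)
    hL j Mc hP one_pos
    (fun J g hJ q => by
      rw [calG_eq_DeltaA_inv]
      exact hG1 (L ^ j) Mc J g hJ q)
    (fun J g hJ p => by
      rw [calG_eq_DeltaA_inv]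
      exact (hG0 (L ^ j) (Nat.one_le_iff_ne_zero.mpr (NeZero.ne _)) (fun _ : Fin (d + 1) => Mc) J g hJ p).trans_eq (mul_comm _ _))
    (fun B g hB p => hE (L ^ j) (Nat.one_le_iff_ne_zero.mpr (NeZero.ne _)) (fun _ : Fin (d + 1) => Mc) 1 one_pos B g hB p)

end

end Summit.QuantumFields.BalabanUV.T4Continuum.NE7StraightSliceB5Letter
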